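import Summits.ResolutionOfSingularities.ResolutionOfSingularities.Theorems.FrobeniusLadderFInjectiveMacaulayficationPointCentreIdealSheaf
import Summits.ResolutionOfSingularities.ResolutionOfSingularities.Theorems.FrobeniusLadderFInjectiveMacaulayficationClosedPointsOfClosedFinite
import Summits.ResolutionOfSingularities.ResolutionOfSingularities.Theorems.FrobeniusLadderFInjectiveMacaulayficationDegreeZeroDescentLocal
import Literature.AlgebraicGeometry.Resolution.BlowupStalkBlowupAlgebra
import HarnessLib

/-!
# §5a T-𝒫-loc — CLOSED CENTRES EXIST AT POINT-FIXABLE BAD POINTS (crux `FInjectiveMacaulayfication`, chain w45a)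

Support file for crux stmt-ResolutionOfSingularities-15315 (`FrobeniusLadder.FInjectiveMacaulayfication`), chain w45a, seat
res-L1-w45a-stub-1 (RULING R11.7 of res-L1-w45a-plan-1). [OURS · L1 W4.5a] — NOT a statement of the manuscript under review;
AI-written, weaker than expert review. Statement = `L/w45a/ClassGlueSig.lean` v3 sha16 74b6a04e74c75940 §5a
`stub_pointFixable_h4` VERBATIM (name without `stub_`): hypothesis (ii) of G-β-rel
(`SequentialSurgeryGlueOfClass.sequentialSurgeryGlueOfClass`, p505685) for the RING-LOCAL point-fixable class

  `P_loc X₁ f₁ b :≡ PFix (𝒪_{X₁,b})` := ∃ n (c : Fin n → 𝒪_b), (c) ≠ 0 ∧ √(c) = 𝔪_b ∧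
      ∀ j, ∀ primes 𝔔 of 𝒪_b[(c)/c_j] over 𝔪_b : FULL CLAUSE at (𝒪_b[(c)/c_j])_𝔔

(`𝒪_b[I/a] = Literature…blowupAlgebra I a`; full clause = domain ∧ Cohen–Macaulay ∧ Frobenius-closed parameter ideals, inline).

PROOF. `X₁` is Noetherian (`ClosedPointsOfClosedFinite.isNoetherian_of_locallyOfFiniteType_of_quasiCompact`). Take an affine
open `U ∋ b`; `Γ(X₁, U) → 𝒪_b` is the localization at `𝔭_b` (`IsAffineOpen.isLocalization_stalk`). Spread the centre out:
`Ĩ := (c) ∩ Γ(X₁, U)`; `Ĩ·𝒪_b = (c)` (`IsLocalization.map_under`), so `Ĩ ≠ 0`; the zero locus of `Ĩ` on `U` is `{b}`: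
`Ĩ ≤ 𝔪_b ∩ Γ(U) = 𝔭_b`, and `Ĩ ≤ 𝔭_x` forces `𝔭_b ≤ 𝔭_x` (every `a ∈ 𝔭_b` has `a/1 ∈ 𝔪_b = √(c)`, so `aᵐ ∈ Ĩ ≤ 𝔭_x`), i.e.
`b ⤳ x` (`PrimeSpectrum.le_iff_specializes`, `IsAffineOpen.fromSpec_primeIdealOf`), i.e. `x = b` (`b` closed). The point-centre
ideal sheaf `J` of `Ĩ` (`PointCentreIdealSheaf.stub_pointCentreIdealSheaf`: `J(U) = Ĩ`, `supp J = {b}`) is the closed centre: for a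
blowing up `π : X' ⟶ X₁` along `J` and `x'` over `b`, `J_b = Ĩ·𝒪_b = (c)` (`Literature…stalkIdeal_eq_map_germ`) and the tree's
dictionary `Literature…IsBlowup.exists_blowupAlgebra_stalk_ringEquiv_of_eq` (Stacks 0804) gives `𝒪_{X',x'} ≅ (𝒪_b[(c)/c_j])_𝔔`
for some `j` and some prime `𝔔` over `𝔪_b`, where the `PFix` clause holds; the clause moves along ring isomorphisms
(`DegreeZeroDescent.inlineClause_of_ringEquiv`, `MulEquiv.isDomain`).

* `under_le_primeIdealOf_iff` — the zero locus of the spread-out centre;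
* `pointFixable_h4` — the §5a statement.

No definitions, no named facts, no `sorry`. [folklore]
-/

-- single-problem summit: the doubled namespace component is forced
set_option linter.dupNamespace false

noncomputable section

namespace Summit.ResolutionOfSingularities.ResolutionOfSingularities.Theorems.FInjectiveMacaulayfication.PointFixableCentre

open AlgebraicGeometry CategoryTheory Literature.AlgebraicGeometry.Resolution TopologicalSpace
open Summit.ResolutionOfSingularities.ResolutionOfSingularities.Theorems.FInjectiveMacaulayfication

/-- **The zero locus of a spread-out `𝔪_b`-primary ideal.** For an affine open `U ∋ b` of a scheme `X` with `b` a closed point,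
and an ideal `I` of `𝒪_{X,b}` with `√I = 𝔪_b`, the contraction `Ĩ = I ∩ Γ(X, U)` (along the germ map, a localization at `𝔭_b`)
satisfies `Ĩ ≤ 𝔭_x ↔ x = b` for `x ∈ U`. [folklore] -/
theorem under_le_primeIdealOf_iff (X : Scheme.{0}) (U : X.affineOpens) (b : X) (hbU : b ∈ (U : X.Opens))
    (hb : IsClosed ({b} : Set X)) (I : Ideal (X.presheaf.stalk b))
    (hrad : I.radical = IsLocalRing.maximalIdeal (X.presheaf.stalk b)) (x : X) (hx : x ∈ (U : X.Opens)) :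
    letI := TopCat.Presheaf.algebra_section_stalk X.presheaf (⟨b, hbU⟩ : (U : X.Opens))
    I.under Γ(X, U) ≤ (U.2.primeIdealOf ⟨x, hx⟩).asIdeal ↔ x = b := by
  letI := TopCat.Presheaf.algebra_section_stalk X.presheaf (⟨b, hbU⟩ : (U : X.Opens))
  haveI : IsLocalization.AtPrime (X.presheaf.stalk b) (U.2.primeIdealOf ⟨b, hbU⟩).asIdeal :=
    U.2.isLocalization_stalk ⟨b, hbU⟩
  have hpb : (IsLocalRing.maximalIdeal (X.presheaf.stalk b)).under Γ(X, U) = (U.2.primeIdealOf ⟨b, hbU⟩).asIdeal :=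
    IsLocalization.AtPrime.under_maximalIdeal (X.presheaf.stalk b) (U.2.primeIdealOf ⟨b, hbU⟩).asIdeal
  constructor
  · intro hle
    -- `𝔭_b ≤ 𝔭_x`
    have hbx : (U.2.primeIdealOf ⟨b, hbU⟩).asIdeal ≤ (U.2.primeIdealOf ⟨x, hx⟩).asIdeal := by
      intro a ha
      have ha' : algebraMap Γ(X, U) (X.presheaf.stalk b) a ∈ I.radical := by
        rw [hrad]
        exact (IsLocalization.AtPrime.to_map_mem_maximal_iff (X.presheaf.stalk b)
          (U.2.primeIdealOf ⟨b, hbU⟩).asIdeal a).mpr ha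
      obtain ⟨m, hm⟩ := ha'
      have ham : a ^ m ∈ I.under Γ(X, U) := by
        rw [Ideal.under_def, Ideal.mem_comap, map_pow]
        exact hm
      exact (U.2.primeIdealOf ⟨x, hx⟩).isPrime.mem_of_pow_mem m (hle ham)
    -- hence `b ⤳ x`, and `b` is closed
    have hspec : (U.2.primeIdealOf ⟨b, hbU⟩) ⤳ (U.2.primeIdealOf ⟨x, hx⟩) :=
      (PrimeSpectrum.le_iff_specializes _ _).mp hbx
    have hspec' : b ⤳ x := by
      have h := hspec.map U.2.fromSpec.base.hom.continuous
      rwa [show U.2.fromSpec.base.hom (U.2.primeIdealOf ⟨b, hbU⟩) = b from U.2.fromSpec_primeIdealOf ⟨b, hbU⟩,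
        show U.2.fromSpec.base.hom (U.2.primeIdealOf ⟨x, hx⟩) = x from U.2.fromSpec_primeIdealOf ⟨x, hx⟩] at h
    have hmem : x ∈ closure ({b} : Set X) := specializes_iff_mem_closure.mp hspec'
    rw [hb.closure_eq] at hmem
    exact hmem
  · rintro rfl
    rw [← hpb]
    exact Ideal.comap_mono (hrad ▸ Ideal.le_radical)

/-- **§5a — CLOSED CENTRES EXIST AT POINT-FIXABLE BAD POINTS** (`ClassGlueSig` v3 74b6a04e74c75940 `stub_pointFixable_h4`,
verbatim = hypothesis (ii) of G-β-rel `SequentialSurgeryGlueOfClass.sequentialSurgeryGlueOfClass` for `P := P_loc`): at a bad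
closed point `b` of an admissible pair `(X₁, f₁)` (separated, locally of finite type, quasi-compact over `k` of characteristic `p`,
integral, everywhere Cohen–Macaulay, finite bad set) which is POINT-FIXABLE — some `𝔪_b`-primary `(c) ≠ 0` of `𝒪_{X₁,b}` has all
the localizations of its affine blowup algebras `𝒪_b[(c)/c_j]` at primes over `𝔪_b` domains + Cohen–Macaulay + Frobenius-closed
parameter ideals — SOME ideal sheaf `J ≠ ⊥` with `b ∈ supp J` has ALL its blowing ups satisfying the full clause over `supp J`
(the point-centre of the spread-out centre; `supp J = {b}`). [folklore] -/
theorem pointFixable_h4 : ∀ (p : ℕ), p.Prime → ∀ (k : Type) [Field k] [CharP k p]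
    (X₁ : Scheme.{0}) (f₁ : X₁ ⟶ Spec (.of k)),
      IsSeparated f₁ → LocallyOfFiniteType f₁ → QuasiCompact f₁ → IsIntegral X₁ →
      (∀ x : X₁, ∀ d : ℕ, ringKrullDim (X₁.presheaf.stalk x) = d → ∀ s : Fin d → X₁.presheaf.stalk x, (Ideal.span (Set.range s)).radical.IsMaximal → RingTheory.Sequence.IsWeaklyRegular (X₁.presheaf.stalk x) (List.ofFn s)) →
      Set.Finite {x : X₁ | ¬ ∀ d : ℕ, ringKrullDim (X₁.presheaf.stalk x) = d → ∀ s : Fin d → X₁.presheaf.stalk x, (Ideal.span (Set.range s)).radical.IsMaximal → ∀ y : X₁.presheaf.stalk x, (∃ e : ℕ, y ^ p ^ e ∈ Ideal.span ((fun z : X₁.presheaf.stalk x => z ^ p ^ e) '' (Ideal.span (Set.range s) : Set (X₁.presheaf.stalk x)))) → y ∈ Ideal.span (Set.range s)} →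
      ∀ b : X₁, IsClosed ({b} : Set X₁) → (¬ ∀ d : ℕ, ringKrullDim (X₁.presheaf.stalk b) = d → ∀ s : Fin d → X₁.presheaf.stalk b, (Ideal.span (Set.range s)).radical.IsMaximal → ∀ y : X₁.presheaf.stalk b, (∃ e : ℕ, y ^ p ^ e ∈ Ideal.span ((fun z : X₁.presheaf.stalk b => z ^ p ^ e) '' (Ideal.span (Set.range s) : Set (X₁.presheaf.stalk b)))) → y ∈ Ideal.span (Set.range s)) →
      (∃ (n : ℕ) (c : Fin n → X₁.presheaf.stalk b), Ideal.span (Set.range c) ≠ ⊥ ∧ (Ideal.span (Set.range c)).radical = IsLocalRing.maximalIdeal (X₁.presheaf.stalk b) ∧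
        ∀ (j : Fin n) (𝔔 : PrimeSpectrum (Literature.AlgebraicGeometry.Resolution.blowupAlgebra (Ideal.span (Set.range c)) (c j))),
          𝔔.asIdeal.comap (algebraMap (X₁.presheaf.stalk b) (Literature.AlgebraicGeometry.Resolution.blowupAlgebra (Ideal.span (Set.range c)) (c j))) = IsLocalRing.maximalIdeal (X₁.presheaf.stalk b) →
          IsDomain (Localization.AtPrime 𝔔.asIdeal) ∧ ∀ d : ℕ, ringKrullDim (Localization.AtPrime 𝔔.asIdeal) = d → ∀ s : Fin d → Localization.AtPrime 𝔔.asIdeal, (Ideal.span (Set.range s)).radical.IsMaximal → RingTheory.Sequence.IsWeaklyRegular (Localization.AtPrime 𝔔.asIdeal) (List.ofFn s) ∧ ∀ y : Localization.AtPrime 𝔔.asIdeal, (∃ e : ℕ, y ^ p ^ e ∈ Ideal.span ((fun z : Localization.AtPrime 𝔔.asIdeal => z ^ p ^ e) '' (Ideal.span (Set.range s) : Set (Localization.AtPrime 𝔔.asIdeal)))) → y ∈ Ideal.span (Set.range s)) →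
      ∃ J : X₁.IdealSheafData, J ≠ ⊥ ∧ b ∈ (J.support : Set X₁) ∧
        ∀ (X' : Scheme.{0}) (π : X' ⟶ X₁), Literature.AlgebraicGeometry.Resolution.IsBlowup π J →
          ∀ x' : X', π.base x' ∈ (J.support : Set X₁) → IsDomain (X'.presheaf.stalk x') ∧ ∀ d : ℕ, ringKrullDim (X'.presheaf.stalk x') = d → ∀ s : Fin d → X'.presheaf.stalk x', (Ideal.span (Set.range s)).radical.IsMaximal → RingTheory.Sequence.IsWeaklyRegular (X'.presheaf.stalk x') (List.ofFn s) ∧ ∀ y : X'.presheaf.stalk x', (∃ e : ℕ, y ^ p ^ e ∈ Ideal.span ((fun z : X'.presheaf.stalk x' => z ^ p ^ e) '' (Ideal.span (Set.range s) : Set (X'.presheaf.stalk x')))) → y ∈ Ideal.span (Set.range s) := by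
  intro p hp k _ _ X₁ f₁ _ hft hqc hint _ _ b hb _ hfix
  obtain ⟨n, c, hc0, hrad, hgood⟩ := hfix
  haveI : IsNoetherian X₁ := ClosedPointsOfClosedFinite.isNoetherian_of_locallyOfFiniteType_of_quasiCompact f₁
  -- an affine open around `b`; the germ map is the localization at `𝔭_b`
  obtain ⟨U₀, hU₀, hbU, -⟩ := exists_isAffineOpen_mem_and_subset (X := X₁) (x := b) (U := ⊤) (Opens.mem_top b)
  let U : X₁.affineOpens := ⟨U₀, hU₀⟩
  letI := TopCat.Presheaf.algebra_section_stalk X₁.presheaf (⟨b, hbU⟩ : (U : X₁.Opens))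
  haveI : IsLocalization.AtPrime (X₁.presheaf.stalk b) (U.2.primeIdealOf ⟨b, hbU⟩).asIdeal :=
    U.2.isLocalization_stalk ⟨b, hbU⟩
  -- spread the centre out to `U`
  have hmap : ((Ideal.span (Set.range c)).under Γ(X₁, U)).map (algebraMap Γ(X₁, U) (X₁.presheaf.stalk b)) =
      Ideal.span (Set.range c) :=
    IsLocalization.map_under (U.2.primeIdealOf ⟨b, hbU⟩).asIdeal.primeCompl (X₁.presheaf.stalk b) _
  have hI0 : (Ideal.span (Set.range c)).under Γ(X₁, U) ≠ ⊥ := fun h => hc0 (by rw [← hmap, h, Ideal.map_bot])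
  have hzero : ∀ (x : X₁) (hx : x ∈ (U : X₁.Opens)),
      (Ideal.span (Set.range c)).under Γ(X₁, U) ≤ (U.2.primeIdealOf ⟨x, hx⟩).asIdeal ↔ x = b :=
    fun x hx => under_le_primeIdealOf_iff X₁ U b hbU hb _ hrad x hx
  -- the point-centre ideal sheaf of the spread-out centre
  obtain ⟨J, hJU, hsupp, -⟩ := PointCentreIdealSheaf.stub_pointCentreIdealSheaf X₁ U _ b hbU hb hzero
  refine ⟨J, fun hbot => hI0 (by rw [← hJU, hbot]; rfl), by rw [hsupp]; exact Set.mem_singleton b,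
    fun X' π hπ x' hx' => ?_⟩
  rw [hsupp] at hx'
  obtain rfl : π.base x' = b := hx'
  -- `J_b = (c)` and the dictionary: `𝒪_{X',x'} ≅ (𝒪_b[(c)/c_j])_𝔔` with `𝔔` over `𝔪_b`
  have hst : stalkIdeal J (π.base x') = Ideal.span (Set.range c) := by
    rw [stalkIdeal_eq_map_germ J U hbU, hJU]
    exact hmap
  obtain ⟨j, 𝔔, -, e, -, -, -, h𝔔⟩ :=
    hπ.exists_blowupAlgebra_stalk_ringEquiv_of_eq x' c (Ideal.span (Set.range c)) rfl hst.symm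
  obtain ⟨hdom, hq⟩ := hgood j 𝔔 h𝔔
  haveI := hdom
  exact ⟨MulEquiv.isDomain (Localization.AtPrime 𝔔.asIdeal) e.toMulEquiv,
    DegreeZeroDescent.inlineClause_of_ringEquiv p (L := Localization.AtPrime 𝔔.asIdeal) (L' := X'.presheaf.stalk x') e.symm hq⟩

end Summit.ResolutionOfSingularities.ResolutionOfSingularities.Theorems.FInjectiveMacaulayfication.PointFixableCentre

end
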